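import Literature.AlgebraicGeometry.Resolution.GeneralizedStabilityRankOneHenselized
import Literature.AlgebraicGeometry.Resolution.DefectAmbient
import Mathlib.FieldTheory.Normal.Defs
import HarnessLib

/-!
# Henselized inertially generated function fields and the proof of (R4) (Kuhlmann 2010, §2.5, §5)

Topic: `Literature/AlgebraicGeometry/Resolution` (valued function fields). Seventh layer of the
decomposition of the named fact `Kuhlmann2010Stability` (`ValuationDefect.lean`) = F.-V. Kuhlmann,
*Elimination of ramification I: The generalized stability theorem*, Trans. AMS 362 (2010)
5697–5727 = arXiv:1003.5678, **Thm. 1.1**, along the printed proof (§5), below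
`GeneralizedStabilityRankOneHenselized.lean`, whose named fact
`Kuhlmann2010StabilityHenselizedRationalResidueTranscendental` — the henselized rational function
field `K(x)^h` of rank one with a residue-transcendental generator over an algebraically closed
`K` is a defectless field — is what pp. 18–20 of the source prove. This file vendors the
VOCABULARY of §2.5 and the INGREDIENTS of that proof as named facts; the proof itself (the
induction of p. 20) is `HenselizedFunctionFieldsProofs.lean`. The printed argument (pp. 18–20,
for `(F|K,v)` "a henselized inertially generated function field of rank 1 and transcendence
degree 1 with a valuation-transcendental generator over the algebraically closed field `K`" and
a finite extension `E|F`):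

> Since the ramification group is a `p`-group (cf. [En]), `F^sep|F^r` is a `p`-extension. It
> follows from the general theory of `p`-groups … via Galois correspondence that the maximal
> separable subextension of `E.F^r|F^r` is a finite tower of Galois extensions of degree `p`.
> Consequently, `E.F^r|F^r` is a finite tower of normal extensions of degree `p`, either Galois or
> purely inseparable. Then there is already a finite subextension `N|F` of `F^r|F` such that
> `E.N|N` is such a tower. Lemma 2.27 shows that `N` … is again a henselized inertially generated
> function field … Also, it is again of rank 1. By Proposition 2.18 we have `d(E|F,v) = d(E.N|N,v)`,
> hence it suffices to prove that `E.N|N` is defectless. … [p. 20] The proof that `E.N|N` is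
> defectless now proceeds by induction on the number of extensions appearing in the tower. …
> there is a normal subextension `E'|N` of `E.N|N` of degree `p`. By Corollary 4.2 or
> Proposition 3.1, this extension is defectless. From the preceding lemma [Lemma 5.5] we infer
> that `E'` is again a henselized inertially generated function field of rank 1 and transcendence
> degree 1 with a valuation-transcendental generator over `K`. Its rank is 1 since it is an
> algebraic extension of `N`. By induction hypothesis, `(E|E',v)` is also defectless since it has
> a smaller degree than `E|N`. Hence by Lemma 2.13, `(E|N,v)` is defectless.

## Content

Ambient rendering throughout (`ValuedFunctionFields.lean`, `Henselization.lean`, `DefectAmbient.lean`):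
one algebraically closed valued field `(Ω, V)`, fields = `Subfield Ω` valued by restriction of
`V`; for subfields `M ≤ T`: `[T : M] = Subfield.relfinrank M T` (Mathlib), `(vT : vM)` = the
relative index of `valueSubgroup M V ≤ valueSubgroup T V` in `|Ω^×|`, `[Tv : Mv]` = the relative
degree of `residueSubfield M V ≤ residueSubfield T V` in `Ωv` (these ARE `e` and `f` of the
valuation ring `V ∩ T` of `T` over `M`: `ramificationIndex_comap_eq_relIndex`,
`inertiaDegree_comap_eq_relfinrank`, `DefectAmbient.lean`).

* `IsRankOne V M` — `(M, V ∩ M)` has rank one (§2.1), in the overring form of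
  `GeneralizedStabilityRankOne.lean`. DEFINITION.
* `IsDefectlessExtension V M T` — `M ≤ T` finite with `[T : M] = (vT : vM)·[Tv : Mv]` for the
  extension `V ∩ T` of `V ∩ M` (§2.3: "`d(L|K,v) := [L:K]/((vL:vK)[Lv:Kv])` … If `d(L|K,v) = 1`,
  then we call `(L|K,v)` a defectless extension", for a unique extension of `v`; here stated for
  the extension `V ∩ T`, which is the unique one over a henselian `M`). DEFINITION, with
  `isDefectlessExtension_self` and `IsDefectlessExtension.trans` (Lemma 2.13, the direction
  "`(M|L,v)` and `(L|K,v)` defectless ⇒ `(M|K,v)` defectless", by multiplicativity of degree,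
  index and residue degree). PROVED.
* `IsUnramifiedOver V F N` — `N|F` finite unramified (§1.2: "unramified, that is, the residue
  fields form a separable extension … of degree equal to [the degree], and [equal value groups]";
  §2.5). DEFINITION; `isUnramifiedOver_self`. PROVED.
* `IsNormalStep p M T`, `IsNormalPTower p M T` — "normal extension of degree `p`", "finite tower
  of normal extensions of degree `p`" (p. 19). DEFINITIONS (the tower as an inductive predicate).
* `IsHenselizedInertiallyGeneratedRT V K F` — **the class of fields the proof runs in**: `F` is a
  henselized inertially generated function field with a residue-transcendental generator `x`
  over `K`, of rank one (§2.5: "`(F|K,v)` is henselized inertially generated with generator `x`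
  if `(F,v)` is a finite unramified extension of a henselized rational function field with
  generator `x`", `K(x)^h`; rank one carried by `K(x)`, cf. `GeneralizedStabilityRankOneHenselized`).
  DEFINITION; `isHenselizedInertiallyGeneratedRT_henselization` (`K(x)^h` itself). PROVED.
* NAMED FACTS (ingredients of pp. 18–20, each in the form in which the proof consumes it):
  `Kuhlmann2010DefectlessOfResidueCharZero` (Cor. 2.12, typed and general),
  `Kuhlmann2010TameTowerReduction` (p. 18 l. −9 – p. 19 l. 3 with Lemma 2.27),
  `Kuhlmann2010DefectUnramifiedBaseChange` (Prop. 2.18), `Kuhlmann2010NormalDegreePDefectless`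
  (Cor. 4.2 / Prop. 3.1), `Kuhlmann2010FiniteExtensionInertiallyGenerated` (Lemma 5.5 as applied
  on p. 20).

## Sources

* F.-V. Kuhlmann, *Elimination of ramification I: The generalized stability theorem*, Trans.
  Amer. Math. Soc. 362 (2010) 5697–5727 = arXiv:1003.5678: §1.1 (`K^r`, `K^i`, `K^h`), §1.2
  (unramified), §2.1 (Lemmas 2.1–2.4, rank), §2.3 (defect, Cor. 2.12, Lemma 2.13, Thm. 2.14,
  Prop. 2.18), §2.5 (henselized function fields, Lemmas 2.26–2.27), §3 (Prop. 3.1), §4 (Prop. 4.1,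
  Cor. 4.2), §5 (proof of (R4), Lemma 5.5; pp. 18–20). [En] = O. Endler, *Valuation theory*
  (1972); [K6] = F.-V. Kuhlmann, Illinois J. Math. 54 (2010) (Prop. 2.18, Thm. 2.14).

## Rendering notes

* All fields live in `Ω`; "`E.N`" (§1.1: "the field compositum of `L` and `F` inside of `F̃`")
  is `E ⊔ N` in the lattice of subfields; "`N ⊆ F^r` finite over `F`" is rendered, for the fields
  at hand (`vF = vK` divisible, `F` henselian), by "`N|F` finite unramified" — Lemma 2.27, Case II:
  "`vF = vK` is divisible, and since `vE/vF` is finite, `vE = vF`. Hence `(E|F,v)` is unramified";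
  conversely a finite unramified extension of a henselian field lies in its absolute inertia
  field `F^i ⊆ F^r` (§1.1; [En]).
* The residue characteristic `p = char Kv > 0` (standing assumption of the source from §1 on:
  "we will always assume in the following that `p = char(K̄) > 0`") enters as
  `CharP (ResidueField V) p`, `p` prime; the case `char Kv = 0` is Cor. 2.12, vendored separately.
* Faithfulness beats convenience: the facts keep the hypotheses of their printed statements as
  specialised to this class of fields (documented at each fact); nothing is stated for fields the
  source does not cover.
-/

noncomputable section

open IsLocalRing

namespace Literature.AlgebraicGeometry.Resolution

universe u

variable {Ω : Type u} [Field Ω] (V : ValuationSubring Ω)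

/-! ### Rank one, defectless extensions, unramified extensions (ambient) -/

section Vocabulary

/-- **`(M, V ∩ M)` has rank one** (Kuhlmann 2010, §2.1: "It has rank 1 (i.e., its only convex
subgroups are `{0}` and `vK`) if and only if `vK` is archimedean"; convex subgroups ↔ prime
ideals ↔ overrings): the valuation ring `V ∩ M` of the subfield `M ≤ Ω` is not all of `M`, and its
only overrings are itself and `M` (the form used in `GeneralizedStabilityRankOne.lean`;
`nonempty_rankOne_of_overrings`, `CompositeValuations.lean`, turns it into Mathlib's
`Valuation.RankOne` for the valuation of `V ∩ M`). [cite: Kuhlmann2010, Section 2.1] -/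
def IsRankOne (M : Subfield Ω) : Prop :=
  V.comap (algebraMap M Ω) ≠ ⊤ ∧
    ∀ S : ValuationSubring M, V.comap (algebraMap M Ω) ≤ S → S = V.comap (algebraMap M Ω) ∨ S = ⊤

/-- **Defectless finite extension inside `(Ω, V)`** (Kuhlmann 2010, §2.3: for a finite extension
`(L|K,v)` with unique extension of `v`, "`[L:K] = (vL:vK)·[Lv:Kv]·p^ν` … `d(L|K,v) := p^ν` …
If `d(L|K,v) = 1`, then we call `(L|K,v)` a defectless extension"): for subfields `M ≤ T` of
`Ω` with `[T : M]` finite, `[T : M] = (vT : vM)·[Tv : Mv]`, where `vM ≤ vT ≤ |Ω^×|` are the value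
subgroups and `Mv ≤ Tv ≤ Ωv` the residue subfields with respect to `V` — i.e. `e·f = n` for the
extension `V ∩ T` of `V ∩ M` (`DefectAmbient.lean`), which over a henselian `M` is the unique
one, so that this is the source's "defectless extension". [cite: Kuhlmann2010, Section 2.3] -/
def IsDefectlessExtension (M T : Subfield Ω) : Prop :=
  M ≤ T ∧ 0 < Subfield.relfinrank M T ∧
    Subfield.relfinrank M T =
      (valueSubgroup M V).relIndex (valueSubgroup T V) *
        (residueSubfield M V).relfinrank (residueSubfield T V)

/-- **Finite unramified extension inside `(Ω, V)`** (Kuhlmann 2010, §1.2: "unramified, that is,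
the residue fields form a separable extension … of degree equal to [the degree of the fields],
and [the value groups are equal]"; §2.5: "a finite unramified extension of a henselized rational
function field"): `F ≤ N` with `[N : F]` finite and equal to `[Nv : Fv]`, `Nv|Fv` separable, and
`vN = vF`. [cite: Kuhlmann2010, Section 1.2 and Section 2.5] -/
def IsUnramifiedOver (F N : Subfield Ω) : Prop :=
  F ≤ N ∧ 0 < Subfield.relfinrank F N ∧
    Subfield.relfinrank F N = (residueSubfield F V).relfinrank (residueSubfield N V) ∧
    (∀ r ∈ residueSubfield N V, IsSeparable (residueSubfield F V) r) ∧
    valueSubgroup N V = valueSubgroup F V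

variable {V}

/-- `M ≤ T` for a defectless extension. [folklore] -/
theorem IsDefectlessExtension.le {M T : Subfield Ω} (h : IsDefectlessExtension V M T) : M ≤ T :=
  h.1

/-- The trivial extension `M|M` is defectless: `1 = 1·1`. [folklore] -/
theorem isDefectlessExtension_self (M : Subfield Ω) : IsDefectlessExtension V M M := by
  refine ⟨le_rfl, ?_, ?_⟩
  · rw [Subfield.relfinrank_self]
    exact one_pos
  · rw [Subfield.relfinrank_self, Subgroup.relIndex_self, Subfield.relfinrank_self]

/-- `vM ≤ vT` for `M ≤ T`. [folklore] -/
theorem valueSubgroup_subfield_mono {M T : Subfield Ω} (h : M ≤ T) :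
    valueSubgroup M V ≤ valueSubgroup T V :=
  valueSubgroup_le_of_range_subset V (by
    rw [range_algebraMap_subfield, range_algebraMap_subfield]
    exact h)

/-- `Mv ≤ Tv` for `M ≤ T`. [folklore] -/
theorem residueSubfield_subfield_mono {M T : Subfield Ω} (h : M ≤ T) :
    residueSubfield M V ≤ residueSubfield T V :=
  residueSubfield_le_of_range_subset V (by
    rw [range_algebraMap_subfield, range_algebraMap_subfield]
    exact h)

/-- **Kuhlmann 2010, Lemma 2.13 (defectless extensions compose)**: "the defect is
multiplicative … In particular, `(M|K,v)` is defectless if and only if `(M|L,v)` and `(L|K,v)` are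
defectless" — the direction ⇐, for `M ≤ M₁ ≤ T` inside `(Ω, V)`: degrees, indices of value
groups and degrees of residue fields are multiplicative in towers. PROVED.
[cite: Kuhlmann2010, Lemma 2.13] -/
theorem IsDefectlessExtension.trans {M M₁ T : Subfield Ω} (h₁ : IsDefectlessExtension V M M₁)
    (h₂ : IsDefectlessExtension V M₁ T) : IsDefectlessExtension V M T := by
  obtain ⟨hle₁, hpos₁, heq₁⟩ := h₁
  obtain ⟨hle₂, hpos₂, heq₂⟩ := h₂
  have hn : Subfield.relfinrank M T = Subfield.relfinrank M M₁ * Subfield.relfinrank M₁ T :=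
    (Subfield.relfinrank_mul_relfinrank hle₁ hle₂).symm
  refine ⟨hle₁.trans hle₂, ?_, ?_⟩
  · rw [hn]
    exact Nat.mul_pos hpos₁ hpos₂
  · rw [hn, heq₁, heq₂,
      ← Subgroup.relIndex_mul_relIndex _ _ _ (valueSubgroup_subfield_mono hle₁)
        (valueSubgroup_subfield_mono hle₂),
      ← Subfield.relfinrank_mul_relfinrank (residueSubfield_subfield_mono hle₁)
        (residueSubfield_subfield_mono hle₂)]
    ring

/-- `F ≤ N` for an unramified extension. [folklore] -/
theorem IsUnramifiedOver.le {F N : Subfield Ω} (h : IsUnramifiedOver V F N) : F ≤ N :=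
  h.1

/-- `[N : F]` is finite (positive) for an unramified extension. [folklore] -/
theorem IsUnramifiedOver.relfinrank_pos {F N : Subfield Ω} (h : IsUnramifiedOver V F N) :
    0 < Subfield.relfinrank F N :=
  h.2.1

/-- The trivial extension `F|F` is unramified. [folklore] -/
theorem isUnramifiedOver_self (F : Subfield Ω) : IsUnramifiedOver V F F := by
  refine ⟨le_rfl, ?_, ?_, ?_, rfl⟩
  · rw [Subfield.relfinrank_self]
    exact one_pos
  · rw [Subfield.relfinrank_self, Subfield.relfinrank_self]
  · intro r hr
    exact isSeparable_algebraMap (⟨r, hr⟩ : residueSubfield F V)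

end Vocabulary

/-! ### Towers of normal extensions of degree `p` -/

section Towers

/-- **Normal extension of degree `p`** inside `Ω` (p. 19: "a finite tower of normal extensions of
degree `p`, either Galois or purely inseparable"): `M ≤ T` with `[T : M] = p` and `T|M` normal.
[cite: Kuhlmann2010, Section 5, proof of (R4) (p. 19)] -/
def IsNormalStep (p : ℕ) (M T : Subfield Ω) : Prop :=
  ∃ h : M ≤ T, Module.finrank M (Subfield.extendScalars h) = p ∧ Normal M (Subfield.extendScalars h)

/-- **Finite tower of normal extensions of degree `p`** from `M` up to `T` inside `Ω` (p. 19), as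
an inductive predicate: the empty tower `M = T`, or a normal step `M ≤ M₁` of degree `p` followed
by a tower from `M₁` to `T`. [cite: Kuhlmann2010, Section 5, proof of (R4) (p. 19)] -/
inductive IsNormalPTower (p : ℕ) : Subfield Ω → Subfield Ω → Prop
  | refl (M : Subfield Ω) : IsNormalPTower p M M
  | step {M M₁ T : Subfield Ω} :
      IsNormalStep p M M₁ → IsNormalPTower p M₁ T → IsNormalPTower p M T

/-- `M ≤ T` along a normal step. [folklore] -/
theorem IsNormalStep.le {p : ℕ} {M T : Subfield Ω} (h : IsNormalStep p M T) : M ≤ T :=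
  h.1

/-- `[T : M] = p` along a normal step of degree `p`. [folklore] -/
theorem IsNormalStep.relfinrank_eq {p : ℕ} {M T : Subfield Ω} (h : IsNormalStep p M T) :
    Subfield.relfinrank M T = p := by
  obtain ⟨hle, hdeg, -⟩ := h
  rw [Subfield.relfinrank_eq_finrank_of_le hle, hdeg]

/-- `M ≤ T` along a tower. [folklore] -/
theorem IsNormalPTower.le {p : ℕ} {M T : Subfield Ω} (h : IsNormalPTower p M T) : M ≤ T := by
  induction h with
  | refl M => exact le_rfl
  | step h₁ _ ih => exact h₁.le.trans ih

end Towers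

/-! ### Henselized inertially generated function fields with a residue-transcendental generator -/

section HIG

/-- **Henselized inertially generated function field with a residue-transcendental generator,
of rank one, over `K`** (Kuhlmann 2010, §2.5: "a henselized function field `(F|K,v)` will be
called henselized rational with generator `x` if `F = K(x)^h`. We will say that `(F|K,v)` is
henselized inertially generated with generator `x` if `(F,v)` is a finite unramified extension of
a henselized rational function field with generator `x`"; "in the second case a
residue-transcendental generator"; §4, (4.3): "`F = K(x)^h(y)` is of rank 1, where `x` is
residue-transcendental over `K`"). Rendering, for subfields `K, F` of the ambient `(Ω, V)`: there is
`x ∈ Ω` residue-transcendental over `K` (`IsResidueTranscendental`) with `(K(x), V ∩ K(x))` of rank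
one (the source's "of rank 1" for `F`; `F|K(x)` is algebraic, so both have rank one together,
Lemma 2.1 / §2.1) such that `F` is a finite unramified extension (`IsUnramifiedOver`) of the
henselization `K(x)^h = henselization V K(x)` (`Henselization.lean`). The class of fields in which
the proof of (R4), pp. 18–20, runs (with `K` algebraically closed).
[cite: Kuhlmann2010, Section 2.5 and Section 4, (4.3)] -/
def IsHenselizedInertiallyGeneratedRT (K F : Subfield Ω) : Prop :=
  ∃ x : Ω, IsResidueTranscendental V K x ∧
    IsRankOne V (IntermediateField.adjoin K ({x} : Set Ω)).toSubfield ∧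
    IsUnramifiedOver V (henselization V (IntermediateField.adjoin K ({x} : Set Ω)).toSubfield) F

variable {V}

/-- **The henselized rational function field `K(x)^h` itself belongs to the class** (§2.5: it is a
trivial unramified extension of itself), for `x` residue-transcendental over `K` and `K(x)` of rank
one. PROVED. [cite: Kuhlmann2010, Section 2.5] -/
theorem isHenselizedInertiallyGeneratedRT_henselization {K : Subfield Ω} {x : Ω}
    (hx : IsResidueTranscendental V K x)
    (hr : IsRankOne V (IntermediateField.adjoin K ({x} : Set Ω)).toSubfield) :
    IsHenselizedInertiallyGeneratedRT V K
      (henselization V (IntermediateField.adjoin K ({x} : Set Ω)).toSubfield) :=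
  ⟨x, hx, hr, isUnramifiedOver_self _⟩

end HIG

/-! ### The ingredients of pp. 18–20 (named facts) -/

/-- NAMED FACT — **Kuhlmann 2010, Cor. 2.12**: "Every valued field `(K,v)` with `char Kv = 0` is a
defectless field" (from the Lemma of Ostrowski, (2.3): `[L:K] = (vL:vK)·[Lv:Kv]·p^ν` with `p` the
characteristic exponent of `Kv`, "cf. [En], [R]"). Typed, general form: any field `K` with a
valuation ring `O` whose residue field has characteristic `0` is a defectless field
(`IsDefectlessField`). Not in Mathlib (the Lemma of Ostrowski needs the ramification theory of
valued fields). Users take `(h : Kuhlmann2010DefectlessOfResidueCharZero)`.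
[cite: Kuhlmann2010, Cor. 2.12] -/
def Kuhlmann2010DefectlessOfResidueCharZero : Prop :=
  ∀ (K : Type u) [Field K] (O : ValuationSubring K), CharZero (ResidueField O) →
    IsDefectlessField K O

/-- NAMED FACT — **Kuhlmann 2010, §5, proof of (R4): reduction to a tower of normal extensions of
degree `p` over a finite unramified extension** (p. 18 l. −9 – p. 19 l. 3: "Since the
ramification group is a `p`-group (cf. [En]), `F^sep|F^r` is a `p`-extension. It follows from the
general theory of `p`-groups (cf. [H], Chapter III, §7, Satz 7.2 and the following remark) via
Galois correspondence that the maximal separable subextension of `E.F^r|F^r` is a finite tower of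
Galois extensions of degree `p`. Consequently, `E.F^r|F^r` is a finite tower of normal extensions
of degree `p`, either Galois or purely inseparable. Then there is already a finite subextension
`N|F` of `F^r|F` such that `E.N|N` is such a tower"; with **Lemma 2.27**, Case II: for `F`
henselized inertially generated with a residue-transcendental generator over an algebraically
closed `K`, a finite `E|F` within `F^r` is unramified — "`vF = vK` is divisible, and since
`vE/vF` is finite, `vE = vF`. Hence `(E|F,v)` is unramified"). Rendering: `(Ω, V)` algebraically
closed with `char Ωv = p > 0`, `K ≤ Ω` a subfield which is an algebraically closed field, `F` in
the class `IsHenselizedInertiallyGeneratedRT V K`, `E ≥ F` a subfield finite over `F`; then there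
is a finite unramified extension `N` of `F` in `Ω` (`IsUnramifiedOver`) such that the compositum
`E.N = E ⊔ N` is reached from `N` by a finite tower of normal extensions of degree `p`
(`IsNormalPTower`). Its proof needs the absolute ramification field and the structure of the
ramification group ("cf. [En]"), not in Mathlib. Users take `(h : Kuhlmann2010TameTowerReduction)`.
[cite: Kuhlmann2010, Section 5, proof of (R4) (pp. 18–19) and Lemma 2.27] -/
def Kuhlmann2010TameTowerReduction : Prop :=
  ∀ (Ω : Type u) [Field Ω] [IsAlgClosed Ω] (V : ValuationSubring Ω) (p : ℕ) [CharP (ResidueField V) p],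
    p.Prime → ∀ (K F E : Subfield Ω), IsAlgClosed K → IsHenselizedInertiallyGeneratedRT V K F →
    F ≤ E → 0 < Subfield.relfinrank F E →
    ∃ N : Subfield Ω, IsUnramifiedOver V F N ∧ IsNormalPTower p N (E ⊔ N)

/-- NAMED FACT — **Kuhlmann 2010, Prop. 2.18 (the defect is invariant under lifting through
subextensions of `K^r`)**: "Let `(K,v)` be a henselian field and `N` an arbitrary algebraic
extension of `K` within `K^r`. If `L|K` is a finite extension, then `d(L|K,v) = d(L.N|N,v)`"
(proved in [K6]). Rendering inside the algebraically closed `(Ω, V)`, for a FINITE UNRAMIFIED `N|F`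
(a finite unramified extension of a henselian field lies in its absolute inertia field
`F^i ⊆ F^r`, §1.1, [En]): `F ≤ Ω` henselian (`IsHenselianField`, so that `d` is defined:
"Note that `g = 1` if `(K,v)` is henselian"; `N` and `E.N`, being algebraic over `F`, carry the
unique extensions `V ∩ N`, `V ∩ E.N`, Lemma 2.3), `N|F` finite unramified, `E ≥ F` finite; then,
with `d = [· : ·]/((v· : v·)[·v : ·v])` cleared of denominators,
`[E : F]·(v(E.N) : vN)·[(E.N)v : Nv] = [E.N : N]·(vE : vF)·[Ev : Fv]`, i.e.
`d(E|F,v) = d(E.N|N,v)`. Users take `(h : Kuhlmann2010DefectUnramifiedBaseChange)`.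
[cite: Kuhlmann2010, Prop. 2.18] -/
def Kuhlmann2010DefectUnramifiedBaseChange : Prop :=
  ∀ (Ω : Type u) [Field Ω] [IsAlgClosed Ω] (V : ValuationSubring Ω) (F N E : Subfield Ω),
    IsHenselianField F (V.comap (algebraMap F Ω)) → IsUnramifiedOver V F N →
    F ≤ E → 0 < Subfield.relfinrank F E →
    Subfield.relfinrank F E *
        ((valueSubgroup N V).relIndex (valueSubgroup (↥(E ⊔ N)) V) *
          (residueSubfield N V).relfinrank (residueSubfield (↥(E ⊔ N)) V)) =
      Subfield.relfinrank N (E ⊔ N) *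
        ((valueSubgroup F V).relIndex (valueSubgroup E V) *
          (residueSubfield F V).relfinrank (residueSubfield E V))

/-- NAMED FACT — **Kuhlmann 2010, Cor. 4.2 / Prop. 3.1: normal extensions of degree `p` of a
henselized inertially generated function field of rank one with a residue-transcendental
generator over an algebraically closed field are defectless** (p. 20: "there is a normal
subextension `E'|N` of `E.N|N` of degree `p`. By Corollary 4.2 or Proposition 3.1, this extension
is defectless"; Cor. 4.2: "Let `(F|K,v)` be a henselized inertially generated function field of
transcendence degree 1 and rank 1. If `(K,v)` is a defectless field, then every Galois extension
`(E|F,v)` of degree `p` is defectless" — `K` algebraically closed is defectless, and satisfies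
the standing hypothesis (4.1) of §4; Prop. 3.1, the "inseparably defectless" version of Thm. 1.1,
with Thm. 2.14 and Lemma 2.3 (`K(x)^h(y) = K(x,y)^h`) for the purely inseparable steps).
Rendering: `(Ω, V)` algebraically closed with `char Ωv = p > 0`, `K ≤ Ω` an algebraically closed
subfield, `N` in the class `IsHenselizedInertiallyGeneratedRT V K`, `N ≤ N'` normal of degree `p`;
then `(N'|N, v)` is defectless: `p = [N' : N] = (vN' : vN)·[N'v : Nv]` (`IsDefectlessExtension`).
The proof is §§3–4 of the source (Frobenius-closed bases, [K5]; Artin–Schreier and Kummer normal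
forms), not in Mathlib. Users take `(h : Kuhlmann2010NormalDegreePDefectless)`.
[cite: Kuhlmann2010, Cor. 4.2 and Prop. 3.1 (with Section 5, p. 20)] -/
def Kuhlmann2010NormalDegreePDefectless : Prop :=
  ∀ (Ω : Type u) [Field Ω] [IsAlgClosed Ω] (V : ValuationSubring Ω) (p : ℕ) [CharP (ResidueField V) p],
    p.Prime → ∀ (K N N' : Subfield Ω), IsAlgClosed K → IsHenselizedInertiallyGeneratedRT V K N →
    IsNormalStep p N N' → IsDefectlessExtension V N N'

/-- NAMED FACT — **Kuhlmann 2010, Lemma 5.5 (as applied on p. 20): finite extensions stay in the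
class.** Lemma 5.5: "Every henselized function field `(F,v)` of rank 1 and of transcendence degree
1 without transcendence defect over an algebraically closed ground field `K` is a henselized
inertially generated function field with a valuation-transcendental generator"; p. 20: "From the
preceding lemma we infer that `E'` is again a henselized inertially generated function field of
rank 1 and transcendence degree 1 with a valuation-transcendental generator over `K`. Its rank is
1 since it is an algebraic extension of `N`." For `N = K(x)^h(y)` in the class and `E ≥ N` finite:
`E = K(x, y, …)^h` is a henselized function field (Lemma 2.3), of rank one and transcendence
degree `1` with the residue-transcendental `x ∈ E` (no transcendence defect), so Lemma 5.5 —
Case II of its proof, the residue-transcendental case — exhibits `E = K(x')^h(y')` with a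
residue-transcendental generator `x'` and `K(x')^h(y')|K(x')^h` unramified. Rendering: `(Ω, V)`
algebraically closed with `char Ωv = p > 0`, `K ≤ Ω` an algebraically closed subfield, `N` in
`IsHenselizedInertiallyGeneratedRT V K`, `N ≤ E` with `[E : N]` finite ⇒ `E` is in the class. The
printed proof uses Hensel's Lemma in `E` and the non-existence of proper immediate algebraic
extensions (p. 19), not in Mathlib. Users take `(h : Kuhlmann2010FiniteExtensionInertiallyGenerated)`.
[cite: Kuhlmann2010, Lemma 5.5 (with Section 5, p. 20, and Lemma 2.3)] -/
def Kuhlmann2010FiniteExtensionInertiallyGenerated : Prop :=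
  ∀ (Ω : Type u) [Field Ω] [IsAlgClosed Ω] (V : ValuationSubring Ω) (p : ℕ) [CharP (ResidueField V) p],
    p.Prime → ∀ (K N E : Subfield Ω), IsAlgClosed K → IsHenselizedInertiallyGeneratedRT V K N →
    N ≤ E → 0 < Subfield.relfinrank N E → IsHenselizedInertiallyGeneratedRT V K E

end Literature.AlgebraicGeometry.Resolution
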